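import Literature.NumberTheory.Sieve.HeathBrownCubicApproxUBound
import Mathlib.Analysis.SpecialFunctions.Exponential
import HarnessLib

/-!
# Heath-Brown's Lemma 3.7 from Lemma 7.1, VI: the sum over `n` of `|U₁^(n) − Û^(n)|`, general family

Pure-proof file (no definitions) in the deduction of **Lemma 3.7 from the corrected Lemma 7.1** of
D. R. Heath-Brown, *Primes represented by `x³ + 2y³`*, Acta Math. 186 (2001), 1–84, §7 pp. 42–47
(decomposition of **parity.S18**, `Literature.NumberTheory.Sieve.setOf_prime_cube_add_two_mul_cube_infinite`).

The per-`n` bound `U_bound_of_h7` (`HeathBrownCubicApproxUBound`) has the shape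
`E1 + E3ii + E4 + c·[5B_w e_n + L_t B_w e_{n−1} + L_t B_ξ (e_n + 20) + δ e_{n+1}] + (66 + 3δ)(log X)C₇Err`,
`c = C₇M/(τ log X)`, `e_j` the elementary symmetric sums of `w(p) = c_K(p)/p` over
`P0 = {X^τ ≤ p < X^{1−τ}}`. Here (pp. 44–46: "each error term is `O(ξτ^{-5}) = o(1)`"):

* `mu_props`, `delta_le` — the choice `μ = ⌊τξ^{-1}⌋` and `δ = (1 + μ^{-1})^{n+1} − 1 ≤ 6(n+1)τ⁴ ≤ 1`
  for `n ≤ τ^{-1} + 1`;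
* `bracket_le_tau4`, `U_bound_tau4` — with `(log X)^{-1} ≤ τ⁵`: the bracket is `≤ τ⁴ g(n)`,
  `g(n) = (n+2+C₁)(10e_n + 2Λe_{n−1}) + 2(1+C₁)Λ(e_n + 20) + 6(n+1)e_{n+1}`, `Λ = log(2/τ) + 1 ≥ ∑_{P0} w`;
* `sum_add_mul_pow_div_factorial_le`, `sum_bracket_le`, `bracket_total_le` — `e_j ≤ Λ^j/j!`,
  `∑_n g(n) ≤ e^Λ(2Λ² + (30+6C₁)Λ + 10(2+C₁)) + 40(1+C₁)ΛN` and, as `e^Λ = 2e/τ`,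
  `τ⁴ ∑_{n ≤ τ^{-1}+1} g(n) ≤ (1600 + 700C₁)τ²`;
* `U_sum_bound` — `∑_{1≤n≤N} |U₁^(n) − Û^(n)| ≤ ∑_n (E1+E3ii+E4)(n) + (1600+700C₁)C₇Mτ/log X + 70(τ^{-1}+1)(log X)C₇Err`;
* `Upiece_eq_U1piece` — `U^(n) = U₁^(n)` for `n ≥ 3` (p. 13).

The family-dependent terms E1, E3ii, E4 are estimated for `𝒜^(K)` and `ℬ^(K)` in the sequel files.
-/

noncomputable section

open Polynomial NumberField Finset Filter Topology Asymptotics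
open scoped nonZeroDivisors

namespace Literature.NumberTheory.Sieve.CubicSieve

open LFunctions.CubeRootTwoField CubicPrimes
open Literature.NumberTheory.LFunctions (idealNormCount)

/-! ### Exponential-series bookkeeping -/


/-- `∑_{n<N} (n + a) Λ^n/n! ≤ (Λ + a) e^Λ` for `Λ, a ≥ 0`. [folklore] -/
theorem sum_add_mul_pow_div_factorial_le {Λ a : ℝ} (hΛ : 0 ≤ Λ) (ha : 0 ≤ a) (N : ℕ) :
    ∑ n ∈ range N, ((n : ℝ) + a) * (Λ ^ n / n.factorial) ≤ (Λ + a) * Real.exp Λ := by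
  have hexp := Real.sum_le_exp_of_nonneg hΛ
  -- `∑ n Λ^n/n! = Λ ∑_{n<N-1} Λ^n/n!`
  have h1 : ∑ n ∈ range N, (n : ℝ) * (Λ ^ n / n.factorial) ≤ Λ * Real.exp Λ := by
    cases N with
    | zero => simp; positivity
    | succ N =>
      rw [sum_range_succ']
      simp only [Nat.cast_zero, zero_mul, add_zero]
      have : ∀ i ∈ range N, ((i + 1 : ℕ) : ℝ) * (Λ ^ (i + 1) / (i + 1).factorial) = Λ * (Λ ^ i / i.factorial) := by
        intro i _
        rw [Nat.factorial_succ, pow_succ]; push_cast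
        have : (i.factorial : ℝ) ≠ 0 := by positivity
        field_simp
      rw [sum_congr rfl this, ← mul_sum]
      exact mul_le_mul_of_nonneg_left (hexp N) hΛ
  have h2 : ∑ n ∈ range N, a * (Λ ^ n / n.factorial) ≤ a * Real.exp Λ := by
    rw [← mul_sum]; exact mul_le_mul_of_nonneg_left (hexp N) ha
  calc ∑ n ∈ range N, ((n : ℝ) + a) * (Λ ^ n / n.factorial)
      = ∑ n ∈ range N, (n : ℝ) * (Λ ^ n / n.factorial) + ∑ n ∈ range N, a * (Λ ^ n / n.factorial) := by
        rw [← sum_add_distrib]; exact sum_congr rfl fun n _ => by ring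
    _ ≤ Λ * Real.exp Λ + a * Real.exp Λ := add_le_add h1 h2
    _ = (Λ + a) * Real.exp Λ := by ring

/-- **The sum over `n` of the pattern-weight brackets.** With `e_j ≤ Λ^j/j!` (`0 ≤ e_j`, `Λ ≥ 1`,
`C₁ ≥ 0`), the per-`n` weights `g(n) = (n+2+C₁)(10 e_n + 2Λ e_{n−1}) + 2(1+C₁)Λ(e_n + 20) + 6(n+1)e_{n+1}`
satisfy `∑_{1 ≤ n ≤ N} g(n) ≤ e^Λ (2Λ² + (30 + 6C₁)Λ + 10(2 + C₁)) + 40(1+C₁)Λ N` — the bookkeeping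
"`∑_n ξτ^{-1} n (log τ^{-1})^n/n! … which produces `O(ξτ^{-4})` after summing over `n`" of pp. 42–44.
[cite: HeathBrownActa2001, §7 pp. 42–44] -/
theorem sum_bracket_le {Λ C₁ : ℝ} (hΛ : 1 ≤ Λ) (hC₁ : 0 ≤ C₁) (e : ℕ → ℝ)
    (he0 : ∀ j, 0 ≤ e j) (he : ∀ j, e j ≤ Λ ^ j / j.factorial) (N : ℕ) :
    ∑ n ∈ Icc 1 N, (((n : ℝ) + 2 + C₁) * (10 * e n + 2 * Λ * e (n - 1)) +
        2 * (1 + C₁) * Λ * (e n + 20) + 6 * ((n : ℝ) + 1) * e (n + 1)) ≤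
      Real.exp Λ * (2 * Λ ^ 2 + (30 + 6 * C₁) * Λ + 10 * (2 + C₁)) + 40 * (1 + C₁) * Λ * N := by
  have hΛ0 : 0 ≤ Λ := by linarith
  have hexp0 : 0 < Real.exp Λ := Real.exp_pos Λ
  have hf : ∀ j, 0 ≤ Λ ^ j / (j.factorial : ℝ) := fun j => by positivity
  -- `Icc 1 N ⊆ range (N+1)`; extend sums of non-negative terms
  have hsub : Icc 1 N ⊆ range (N + 1) := fun n hn => by
    rw [mem_Icc] at hn; rw [mem_range]; omega
  -- term 1: `∑ (n+2+C₁)·10 e_n ≤ 10 (Λ + 2 + C₁) e^Λ`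
  have t1 : ∑ n ∈ Icc 1 N, ((n : ℝ) + 2 + C₁) * (10 * e n) ≤ 10 * ((Λ + (2 + C₁)) * Real.exp Λ) := by
    calc ∑ n ∈ Icc 1 N, ((n : ℝ) + 2 + C₁) * (10 * e n)
        ≤ ∑ n ∈ range (N + 1), ((n : ℝ) + 2 + C₁) * (10 * e n) :=
          sum_le_sum_of_subset_of_nonneg hsub fun n _ _ => by have := he0 n; positivity
      _ ≤ ∑ n ∈ range (N + 1), 10 * (((n : ℝ) + (2 + C₁)) * (Λ ^ n / n.factorial)) :=
          sum_le_sum fun n _ => by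
            have := he n; have : 0 ≤ (n : ℝ) + 2 + C₁ := by positivity
            nlinarith
      _ = 10 * ∑ n ∈ range (N + 1), ((n : ℝ) + (2 + C₁)) * (Λ ^ n / n.factorial) := by rw [mul_sum]
      _ ≤ 10 * ((Λ + (2 + C₁)) * Real.exp Λ) :=
          mul_le_mul_of_nonneg_left (sum_add_mul_pow_div_factorial_le hΛ0 (by positivity) _) (by norm_num)
  -- term 2: `∑ (n+2+C₁) 2Λ e_{n-1} ≤ 2Λ (Λ + 3 + C₁) e^Λ` (shift `n = m + 1`)
  have t2 : ∑ n ∈ Icc 1 N, ((n : ℝ) + 2 + C₁) * (2 * Λ * e (n - 1)) ≤ 2 * Λ * ((Λ + (3 + C₁)) * Real.exp Λ) := by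
    have hreindex : ∑ n ∈ Icc 1 N, ((n : ℝ) + 2 + C₁) * (2 * Λ * e (n - 1)) =
        ∑ m ∈ range N, (((m + 1 : ℕ) : ℝ) + 2 + C₁) * (2 * Λ * e m) := by
      have : Icc 1 N = (range N).map ⟨fun m => m + 1, fun a b h => by simpa using h⟩ := by
        ext n; simp only [mem_Icc, Finset.mem_map, mem_range, Function.Embedding.coeFn_mk]
        constructor
        · intro h; exact ⟨n - 1, by omega, by omega⟩
        · rintro ⟨m, hm, rfl⟩; omega
      rw [this, sum_map]
      rfl
    rw [hreindex]
    calc ∑ m ∈ range N, (((m + 1 : ℕ) : ℝ) + 2 + C₁) * (2 * Λ * e m)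
        ≤ ∑ m ∈ range N, 2 * Λ * (((m : ℝ) + (3 + C₁)) * (Λ ^ m / m.factorial)) :=
          sum_le_sum fun m _ => by
            have h0 : 0 ≤ ((m : ℝ) + (3 + C₁)) := by positivity
            calc (((m + 1 : ℕ) : ℝ) + 2 + C₁) * (2 * Λ * e m) = 2 * Λ * (((m : ℝ) + (3 + C₁)) * e m) := by
                  push_cast; ring
              _ ≤ 2 * Λ * (((m : ℝ) + (3 + C₁)) * (Λ ^ m / m.factorial)) :=
                  mul_le_mul_of_nonneg_left (mul_le_mul_of_nonneg_left (he m) h0) (by positivity)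
      _ = 2 * Λ * ∑ m ∈ range N, ((m : ℝ) + (3 + C₁)) * (Λ ^ m / m.factorial) := by rw [mul_sum]
      _ ≤ 2 * Λ * ((Λ + (3 + C₁)) * Real.exp Λ) :=
          mul_le_mul_of_nonneg_left (sum_add_mul_pow_div_factorial_le hΛ0 (by positivity) _) (by positivity)
  -- term 3: `∑ 2(1+C₁)Λ e_n ≤ 2(1+C₁)Λ e^Λ` and the constant `20`
  have t3 : ∑ n ∈ Icc 1 N, 2 * (1 + C₁) * Λ * (e n + 20) ≤
      2 * (1 + C₁) * Λ * Real.exp Λ + 40 * (1 + C₁) * Λ * N := by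
    have h1 : ∑ n ∈ Icc 1 N, 2 * (1 + C₁) * Λ * e n ≤ 2 * (1 + C₁) * Λ * Real.exp Λ := by
      calc ∑ n ∈ Icc 1 N, 2 * (1 + C₁) * Λ * e n ≤ ∑ n ∈ range (N + 1), 2 * (1 + C₁) * Λ * e n :=
            sum_le_sum_of_subset_of_nonneg hsub fun n _ _ => by have := he0 n; positivity
        _ ≤ ∑ n ∈ range (N + 1), 2 * (1 + C₁) * Λ * (Λ ^ n / n.factorial) :=
            sum_le_sum fun n _ => mul_le_mul_of_nonneg_left (he n) (by positivity)
        _ = 2 * (1 + C₁) * Λ * ∑ n ∈ range (N + 1), Λ ^ n / n.factorial := by rw [mul_sum]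
        _ ≤ 2 * (1 + C₁) * Λ * Real.exp Λ :=
            mul_le_mul_of_nonneg_left (Real.sum_le_exp_of_nonneg hΛ0 _) (by positivity)
    have h2 : ∑ n ∈ Icc 1 N, 2 * (1 + C₁) * Λ * 20 = 40 * (1 + C₁) * Λ * N := by
      rw [sum_const, Nat.card_Icc, nsmul_eq_mul]; push_cast; ring
    calc ∑ n ∈ Icc 1 N, 2 * (1 + C₁) * Λ * (e n + 20)
        = ∑ n ∈ Icc 1 N, 2 * (1 + C₁) * Λ * e n + ∑ n ∈ Icc 1 N, 2 * (1 + C₁) * Λ * 20 := by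
          rw [← sum_add_distrib]; exact sum_congr rfl fun n _ => by ring
      _ ≤ _ := by rw [h2]; linarith
  -- term 4: `∑ 6(n+1) e_{n+1} ≤ 6Λ e^Λ`
  have t4 : ∑ n ∈ Icc 1 N, 6 * ((n : ℝ) + 1) * e (n + 1) ≤ 6 * (Λ * Real.exp Λ) := by
    calc ∑ n ∈ Icc 1 N, 6 * ((n : ℝ) + 1) * e (n + 1)
        ≤ ∑ n ∈ range (N + 1), 6 * ((n : ℝ) + 1) * e (n + 1) :=
          sum_le_sum_of_subset_of_nonneg hsub fun n _ _ => by have := he0 (n + 1); positivity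
      _ ≤ ∑ n ∈ range (N + 1), 6 * (Λ * (Λ ^ n / n.factorial)) :=
          sum_le_sum fun n _ => by
            have h := he (n + 1)
            have hkey : ((n : ℝ) + 1) * (Λ ^ (n + 1) / (n + 1).factorial) = Λ * (Λ ^ n / n.factorial) := by
              rw [Nat.factorial_succ, pow_succ]; push_cast
              have : (n.factorial : ℝ) ≠ 0 := by positivity
              field_simp
            have h0 : (0 : ℝ) ≤ (n : ℝ) + 1 := by positivity
            calc 6 * ((n : ℝ) + 1) * e (n + 1) ≤ 6 * ((n : ℝ) + 1) * (Λ ^ (n + 1) / (n + 1).factorial) :=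
                  mul_le_mul_of_nonneg_left h (by positivity)
              _ = 6 * (Λ * (Λ ^ n / n.factorial)) := by rw [mul_assoc, hkey]
      _ = 6 * (Λ * ∑ n ∈ range (N + 1), Λ ^ n / n.factorial) := by rw [mul_sum, mul_sum]
      _ ≤ 6 * (Λ * Real.exp Λ) :=
          mul_le_mul_of_nonneg_left (mul_le_mul_of_nonneg_left (Real.sum_le_exp_of_nonneg hΛ0 _) hΛ0) (by norm_num)
  -- combine
  have hsplit : ∑ n ∈ Icc 1 N, (((n : ℝ) + 2 + C₁) * (10 * e n + 2 * Λ * e (n - 1)) +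
        2 * (1 + C₁) * Λ * (e n + 20) + 6 * ((n : ℝ) + 1) * e (n + 1)) =
      ∑ n ∈ Icc 1 N, ((n : ℝ) + 2 + C₁) * (10 * e n) + ∑ n ∈ Icc 1 N, ((n : ℝ) + 2 + C₁) * (2 * Λ * e (n - 1)) +
      ∑ n ∈ Icc 1 N, 2 * (1 + C₁) * Λ * (e n + 20) + ∑ n ∈ Icc 1 N, 6 * ((n : ℝ) + 1) * e (n + 1) := by
    rw [← sum_add_distrib, ← sum_add_distrib, ← sum_add_distrib]
    exact sum_congr rfl fun n _ => by ring
  rw [hsplit]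
  have p1 : 0 ≤ Real.exp Λ * Λ := by positivity
  have p2 : 0 ≤ Real.exp Λ * (C₁ * Λ) := by positivity
  have hbound : 10 * ((Λ + (2 + C₁)) * Real.exp Λ) + 2 * Λ * ((Λ + (3 + C₁)) * Real.exp Λ) +
      (2 * (1 + C₁) * Λ * Real.exp Λ + 40 * (1 + C₁) * Λ * N) + 6 * (Λ * Real.exp Λ) ≤
      Real.exp Λ * (2 * Λ ^ 2 + (30 + 6 * C₁) * Λ + 10 * (2 + C₁)) + 40 * (1 + C₁) * Λ * N := by
    nlinarith [p1, p2]
  linarith [t1, t2, t3, t4, hbound]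

/-- **Numerical size of the summed brackets**: for `Λ = log(2/τ) + 1`, `0 < τ ≤ 1`,
`τ⁴ · (e^Λ (2Λ² + (30+6C₁)Λ + 10(2+C₁)) + 40(1+C₁)Λ(1/τ + 2)) ≤ (1600 + 700 C₁) τ²`
(`e^Λ = 2e/τ`, `Λ ≤ 2√(2/τ) + 1`). [folklore] -/
theorem bracket_total_le {τ C₁ : ℝ} (hτ : 0 < τ) (hτ1 : τ ≤ 1) (hC₁ : 0 ≤ C₁) :
    τ ^ 4 * (Real.exp (Real.log (2 / τ) + 1) * (2 * (Real.log (2 / τ) + 1) ^ 2 +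
        (30 + 6 * C₁) * (Real.log (2 / τ) + 1) + 10 * (2 + C₁)) +
      40 * (1 + C₁) * (Real.log (2 / τ) + 1) * (1 / τ + 2)) ≤ (1600 + 700 * C₁) * τ ^ 2 := by
  set Λ := Real.log (2 / τ) + 1 with hΛ
  have h2τ : 0 < 2 / τ := by positivity
  have h2τ1 : 2 ≤ 2 / τ := by rw [le_div_iff₀ hτ]; nlinarith
  have hexp : Real.exp Λ = 2 / τ * Real.exp 1 := by
    rw [hΛ, Real.exp_add, Real.exp_log h2τ]
  have he3 : Real.exp 1 ≤ 3 := by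
    have := Real.exp_one_lt_d9; linarith
  have hlog0 : 0 ≤ Real.log (2 / τ) := Real.log_nonneg (by linarith)
  have hΛ1 : 1 ≤ Λ := by rw [hΛ]; linarith
  -- `Λ ≤ 2√(2/τ) + 1`, so `Λ² ≤ 16/τ + 2`... we use `Λ √τ ≤ 2√2 + 1 ≤ 4`
  have hsqrt : 0 < Real.sqrt τ := Real.sqrt_pos.mpr hτ
  have hst : Real.sqrt τ ^ 2 = τ := Real.sq_sqrt hτ.le
  have hs1 : Real.sqrt τ ≤ 1 := by rw [Real.sqrt_le_one]; exact hτ1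
  have hΛs : Λ * Real.sqrt τ ≤ 4 := by
    have h1 : Real.log (2 / τ) ≤ 2 * Real.sqrt (2 / τ) := by
      have e1 : Real.log (2 / τ) = 2 * Real.log (Real.sqrt (2 / τ)) := by
        rw [Real.log_sqrt h2τ.le]; ring
      have e2 := Real.log_le_sub_one_of_pos (Real.sqrt_pos.mpr h2τ)
      linarith
    have h2 : Real.sqrt (2 / τ) * Real.sqrt τ = Real.sqrt 2 := by
      rw [← Real.sqrt_mul h2τ.le, div_mul_cancel₀ _ hτ.ne']
    have h3 : Real.sqrt 2 ≤ 3 / 2 := by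
      rw [Real.sqrt_le_left (by norm_num)]; norm_num
    calc Λ * Real.sqrt τ = Real.log (2 / τ) * Real.sqrt τ + Real.sqrt τ := by rw [hΛ]; ring
      _ ≤ 2 * Real.sqrt (2 / τ) * Real.sqrt τ + 1 := by nlinarith
      _ = 2 * Real.sqrt 2 + 1 := by rw [mul_assoc, h2]
      _ ≤ 4 := by linarith
  -- hence `τ Λ² ≤ 16` and `τ Λ ≤ 4 √τ ≤ 4`
  have hτΛ2 : τ * Λ ^ 2 ≤ 16 := by
    have hΛs0 : 0 ≤ Λ * Real.sqrt τ := by positivity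
    calc τ * Λ ^ 2 = (Λ * Real.sqrt τ) ^ 2 := by rw [mul_pow, hst]; ring
      _ ≤ 4 ^ 2 := pow_le_pow_left₀ hΛs0 hΛs 2
      _ = 16 := by norm_num
  have hτΛ : τ * Λ ≤ 4 := by
    calc τ * Λ = (Λ * Real.sqrt τ) * Real.sqrt τ := by rw [mul_assoc, ← sq, hst]; ring
      _ ≤ 4 * 1 := mul_le_mul hΛs hs1 hsqrt.le (by norm_num)
      _ = 4 := by ring
  have hΛ0 : 0 ≤ Λ := by linarith
  have hτ3 : τ ^ 3 ≤ τ ^ 2 := by nlinarith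
  have ha : τ ^ 3 * Λ ^ 2 ≤ 16 * τ ^ 2 := by
    calc τ ^ 3 * Λ ^ 2 = τ ^ 2 * (τ * Λ ^ 2) := by ring
      _ ≤ τ ^ 2 * 16 := mul_le_mul_of_nonneg_left hτΛ2 (by positivity)
      _ = 16 * τ ^ 2 := by ring
  have hb : τ ^ 3 * Λ ≤ 4 * τ ^ 2 := by
    calc τ ^ 3 * Λ = τ ^ 2 * (τ * Λ) := by ring
      _ ≤ τ ^ 2 * 4 := mul_le_mul_of_nonneg_left hτΛ (by positivity)
      _ = 4 * τ ^ 2 := by ring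
  have hb4 : τ ^ 4 * Λ ≤ 4 * τ ^ 3 := by
    calc τ ^ 4 * Λ = τ ^ 3 * (τ * Λ) := by ring
      _ ≤ τ ^ 3 * 4 := mul_le_mul_of_nonneg_left hτΛ (by positivity)
      _ = 4 * τ ^ 3 := by ring
  have hbC : C₁ * (τ ^ 3 * Λ) ≤ C₁ * (4 * τ ^ 2) := mul_le_mul_of_nonneg_left hb hC₁
  have hb4C : C₁ * (τ ^ 4 * Λ) ≤ C₁ * (4 * τ ^ 3) := mul_le_mul_of_nonneg_left hb4 hC₁
  have hτ3C : C₁ * τ ^ 3 ≤ C₁ * τ ^ 2 := mul_le_mul_of_nonneg_left hτ3 hC₁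
  -- first part
  have hp1 : τ ^ 4 * (Real.exp Λ * (2 * Λ ^ 2 + (30 + 6 * C₁) * Λ + 10 * (2 + C₁))) ≤
      (1032 + 204 * C₁) * τ ^ 2 := by
    rw [hexp]
    have h2 : τ ^ 3 * (2 * Λ ^ 2 + (30 + 6 * C₁) * Λ + 10 * (2 + C₁)) ≤ (172 + 34 * C₁) * τ ^ 2 := by
      have e : τ ^ 3 * (2 * Λ ^ 2 + (30 + 6 * C₁) * Λ + 10 * (2 + C₁)) =
          2 * (τ ^ 3 * Λ ^ 2) + 30 * (τ ^ 3 * Λ) + 6 * (C₁ * (τ ^ 3 * Λ)) + 20 * τ ^ 3 + 10 * (C₁ * τ ^ 3) := by ring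
      rw [e]; linarith
    have h1 : τ ^ 4 * (2 / τ * Real.exp 1 * (2 * Λ ^ 2 + (30 + 6 * C₁) * Λ + 10 * (2 + C₁))) =
        2 * Real.exp 1 * (τ ^ 3 * (2 * Λ ^ 2 + (30 + 6 * C₁) * Λ + 10 * (2 + C₁))) := by
      field_simp
    rw [h1]
    have h0 : 0 ≤ τ ^ 3 * (2 * Λ ^ 2 + (30 + 6 * C₁) * Λ + 10 * (2 + C₁)) := by positivity
    have h3 : 2 * Real.exp 1 ≤ 6 := by linarith
    calc 2 * Real.exp 1 * (τ ^ 3 * (2 * Λ ^ 2 + (30 + 6 * C₁) * Λ + 10 * (2 + C₁)))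
        ≤ 6 * ((172 + 34 * C₁) * τ ^ 2) := mul_le_mul h3 h2 h0 (by norm_num)
      _ = (1032 + 204 * C₁) * τ ^ 2 := by ring
  -- second part
  have hp2 : τ ^ 4 * (40 * (1 + C₁) * Λ * (1 / τ + 2)) ≤ (480 + 480 * C₁) * τ ^ 2 := by
    have h1 : τ ^ 4 * (40 * (1 + C₁) * Λ * (1 / τ + 2)) =
        40 * (τ ^ 3 * Λ) + 40 * (C₁ * (τ ^ 3 * Λ)) + 80 * (τ ^ 4 * Λ) + 80 * (C₁ * (τ ^ 4 * Λ)) := by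
      field_simp; ring
    rw [h1]; linarith
  calc _ = τ ^ 4 * (Real.exp Λ * (2 * Λ ^ 2 + (30 + 6 * C₁) * Λ + 10 * (2 + C₁))) +
        τ ^ 4 * (40 * (1 + C₁) * Λ * (1 / τ + 2)) := by ring
    _ ≤ (1032 + 204 * C₁) * τ ^ 2 + (480 + 480 * C₁) * τ ^ 2 := add_le_add hp1 hp2
    _ ≤ (1600 + 700 * C₁) * τ ^ 2 := by nlinarith [sq_nonneg τ]



/-! ### The auxiliary integer `μ = ⌊τ/ξ⌋` and the weight error `δ` -/

/-- `μ = ⌊τξ^{-1}⌋ = ⌊τ^{-4}⌋` satisfies `1 ≤ μ ≤ τξ^{-1}` and `μ^{-1} ≤ 2ξτ^{-1} = 2τ⁴` (`0 < τ ≤ 1`).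
[folklore] -/
theorem mu_props {τ : ℝ} (hτ : 0 < τ) (hτ1 : τ ≤ 1) :
    1 ≤ ⌊τ / hbXi τ⌋₊ ∧ ((⌊τ / hbXi τ⌋₊ : ℕ) : ℝ) ≤ τ / hbXi τ ∧
      1 / ((⌊τ / hbXi τ⌋₊ : ℕ) : ℝ) ≤ 2 * τ ^ 4 := by
  have hξ := hbXi_pos hτ
  set y : ℝ := τ / hbXi τ with hydef
  have hτ4 : 0 < τ ^ 4 := by positivity
  have hyτ : τ ^ 4 * y = 1 := by rw [hydef, hbXi]; field_simp
  have hτ41 : τ ^ 4 ≤ 1 := pow_le_one₀ hτ.le hτ1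
  have hy0 : 0 < y := by rw [hydef]; positivity
  have hy1 : 1 ≤ y := by nlinarith
  have h1 : 1 ≤ ⌊y⌋₊ := Nat.le_floor (by exact_mod_cast hy1)
  refine ⟨h1, Nat.floor_le hy0.le, ?_⟩
  have hfl : y < ⌊y⌋₊ + 1 := Nat.lt_floor_add_one _
  have hμpos : (0 : ℝ) < ⌊y⌋₊ := by exact_mod_cast h1
  have hμ1 : (1 : ℝ) ≤ ⌊y⌋₊ := by exact_mod_cast h1
  rw [div_le_iff₀ hμpos]
  -- `⌊y⌋ ≥ y/2` for `y ≥ 1`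
  rcases le_or_gt 2 y with h2 | h2
  · have hτ4le : 2 * τ ^ 4 ≤ 1 := by nlinarith
    have e1 : 2 * τ ^ 4 * (y - 1) = 2 * (τ ^ 4 * y) - 2 * τ ^ 4 := by ring
    have h3 : 1 ≤ 2 * τ ^ 4 * (y - 1) := by rw [e1, hyτ]; linarith
    exact h3.trans (mul_le_mul_of_nonneg_left (by linarith) (by positivity))
  · have h3 : 1 < 2 * τ ^ 4 := by nlinarith
    calc (1 : ℝ) ≤ 2 * τ ^ 4 * 1 := by linarith
      _ ≤ 2 * τ ^ 4 * ⌊y⌋₊ := mul_le_mul_of_nonneg_left hμ1 (by positivity)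

/-- **The weight error `δ = (1 + 1/μ)^{n+1} − 1 ≤ 6(n+1)τ⁴ ≤ 1`** for `n + 1 ≤ 1/τ + 2`,
`0 < τ ≤ 1/40`, `μ = ⌊τξ^{-1}⌋` ("`1 ≤ d_S ≤ 1 + O(ξτ^{-2})`", p. 44). [cite: HeathBrownActa2001, §7 p. 44] -/
theorem delta_le {τ : ℝ} (hτ : 0 < τ) (hτ1 : τ ≤ 1 / 40) {n : ℕ} (hn : (n : ℝ) ≤ 1 / τ + 1) :
    (1 + 1 / ((⌊τ / hbXi τ⌋₊ : ℕ) : ℝ)) ^ (n + 1) - 1 ≤ 6 * ((n : ℝ) + 1) * τ ^ 4 ∧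
      6 * ((n : ℝ) + 1) * τ ^ 4 ≤ 1 := by
  obtain ⟨h1, -, hinv⟩ := mu_props hτ (by linarith)
  set x : ℝ := 1 / ((⌊τ / hbXi τ⌋₊ : ℕ) : ℝ) with hx
  have hx0 : 0 ≤ x := by rw [hx]; positivity
  have hk : ((n : ℝ) + 1) * x ≤ 1 := by
    calc ((n : ℝ) + 1) * x ≤ (1 / τ + 2) * (2 * τ ^ 4) := mul_le_mul (by linarith) hinv hx0 (by positivity)
      _ = 2 * τ ^ 3 + 4 * τ ^ 4 := by field_simp; ring
      _ ≤ 1 := by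
        have h3 : τ ^ 3 ≤ τ := pow_le_of_le_one hτ.le (by linarith) (by norm_num)
        have h4 : τ ^ 4 ≤ τ := pow_le_of_le_one hτ.le (by linarith) (by norm_num)
        linarith
  have hpow : (1 + x) ^ (n + 1) ≤ 3 := by
    calc (1 + x) ^ (n + 1) ≤ Real.exp x ^ (n + 1) :=
          pow_le_pow_left₀ (by linarith) (by have := Real.add_one_le_exp x; linarith) _
      _ = Real.exp (((n : ℝ) + 1) * x) := by rw [← Real.exp_nat_mul]; push_cast; ring_nf
      _ ≤ Real.exp 1 := Real.exp_le_exp.mpr hk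
      _ ≤ 3 := by have := Real.exp_one_lt_d9; linarith
  have hmain := one_add_pow_sub_one_le hx0 (n + 1)
  have h6 : 6 * ((n : ℝ) + 1) * τ ^ 4 ≤ 1 := by
    calc 6 * ((n : ℝ) + 1) * τ ^ 4 ≤ 6 * (1 / τ + 2) * τ ^ 4 :=
          mul_le_mul_of_nonneg_right (mul_le_mul_of_nonneg_left (by linarith) (by norm_num)) (by positivity)
      _ = 6 * τ ^ 3 + 12 * τ ^ 4 := by field_simp; ring
      _ ≤ 1 := by
        have h3 : τ ^ 3 ≤ τ := pow_le_of_le_one hτ.le (by linarith) (by norm_num)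
        have h4 : τ ^ 4 ≤ τ := pow_le_of_le_one hτ.le (by linarith) (by norm_num)
        linarith
  refine ⟨hmain.trans ?_, h6⟩
  calc ((n + 1 : ℕ) : ℝ) * x * (1 + x) ^ (n + 1) ≤ ((n : ℝ) + 1) * (2 * τ ^ 4) * 3 := by
        push_cast
        exact mul_le_mul (mul_le_mul_of_nonneg_left hinv (by positivity)) hpow (by positivity) (by positivity)
    _ = 6 * ((n : ℝ) + 1) * τ ^ 4 := by ring


/-! ### The bracket of weights is `≤ τ⁴ g(n)` -/

/-- **Scalar bookkeeping for the weight bracket** of `U_bound_of_h7`: with `ξ = τ⁵`,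
`(log X)^{-1} ≤ τ⁵`, `∑_{P0} w ≤ Λ` and `δ ≤ 6(n+1)τ⁴`,
`5 B_w e_n + L_t B_w e_{n-1} + L_t B_ξ (e_n + 20) + δ e_{n+1} ≤ τ⁴ g(n)` with
`g(n) = (n+2+C₁)(10 e_n + 2Λ e_{n-1}) + 2(1+C₁)Λ(e_n+20) + 6(n+1) e_{n+1}`. [folklore] -/
theorem bracket_le_tau4 {τ L Lt Λ C₁ en en1 enp1 δ : ℝ} {n : ℕ} (hτ : 0 < τ) (hL : 0 < L)
    (hLτ : 1 / L ≤ τ ^ 5) (hC₁ : 0 ≤ C₁) (hLt0 : 0 ≤ Lt) (hLtΛ : Lt ≤ Λ)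
    (hen : 0 ≤ en) (hen1 : 0 ≤ en1) (henp1 : 0 ≤ enp1) (hδ : δ ≤ 6 * ((n : ℝ) + 1) * τ ^ 4) :
    5 * (2 * ((n + 1) * hbXi τ * L + Real.log 2 + C₁) / (τ * L)) * en +
      Lt * (2 * ((n + 1) * hbXi τ * L + Real.log 2 + C₁) / (τ * L)) * en1 +
      Lt * (2 * (hbXi τ * L + C₁) / (τ * L)) * (en + 20) +
      δ * enp1 ≤
    τ ^ 4 * (((n : ℝ) + 2 + C₁) * (10 * en + 2 * Λ * en1) + 2 * (1 + C₁) * Λ * (en + 20) +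
      6 * ((n : ℝ) + 1) * enp1) := by
  have hξ : hbXi τ = τ ^ 5 := rfl
  have hτL : 1 ≤ τ ^ 5 * L := by rwa [div_le_iff₀ hL] at hLτ
  have hlog2 : Real.log 2 ≤ 1 := by have := Real.log_two_lt_d9; linarith
  have hlog2' : 0 ≤ Real.log 2 := Real.log_nonneg (by norm_num)
  have hΛ0 : 0 ≤ Λ := hLt0.trans hLtΛ
  set Bw : ℝ := 2 * ((n + 1) * hbXi τ * L + Real.log 2 + C₁) / (τ * L) with hBw_def
  set Bξ : ℝ := 2 * (hbXi τ * L + C₁) / (τ * L) with hBξ_def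
  have hBw : Bw ≤ 2 * ((n : ℝ) + 2 + C₁) * τ ^ 4 := by
    rw [hBw_def, div_le_iff₀ (by positivity), hξ]
    have key : Real.log 2 + C₁ ≤ (1 + C₁) * (τ ^ 5 * L) := by nlinarith
    calc 2 * (((n : ℝ) + 1) * τ ^ 5 * L + Real.log 2 + C₁)
        = 2 * ((n : ℝ) + 1) * (τ ^ 5 * L) + 2 * (Real.log 2 + C₁) := by ring
      _ ≤ 2 * ((n : ℝ) + 1) * (τ ^ 5 * L) + 2 * ((1 + C₁) * (τ ^ 5 * L)) := by linarith
      _ = 2 * ((n : ℝ) + 2 + C₁) * τ ^ 4 * (τ * L) := by ring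
  have hBξ : Bξ ≤ 2 * (1 + C₁) * τ ^ 4 := by
    rw [hBξ_def, div_le_iff₀ (by positivity), hξ]
    have key : C₁ * 1 ≤ C₁ * (τ ^ 5 * L) := mul_le_mul_of_nonneg_left hτL hC₁
    calc 2 * (τ ^ 5 * L + C₁) ≤ 2 * (τ ^ 5 * L + C₁ * (τ ^ 5 * L)) := by linarith
      _ = 2 * (1 + C₁) * τ ^ 4 * (τ * L) := by ring
  have hBw0 : 0 ≤ Bw := by rw [hBw_def, hξ]; positivity
  have hBξ0 : 0 ≤ Bξ := by rw [hBξ_def, hξ]; positivity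
  have t1 : 5 * Bw * en ≤ 5 * (2 * ((n : ℝ) + 2 + C₁) * τ ^ 4) * en :=
    mul_le_mul_of_nonneg_right (mul_le_mul_of_nonneg_left hBw (by norm_num)) hen
  have t2 : Lt * Bw * en1 ≤ Λ * (2 * ((n : ℝ) + 2 + C₁) * τ ^ 4) * en1 :=
    mul_le_mul_of_nonneg_right (mul_le_mul hLtΛ hBw hBw0 hΛ0) hen1
  have t3 : Lt * Bξ * (en + 20) ≤ Λ * (2 * (1 + C₁) * τ ^ 4) * (en + 20) :=
    mul_le_mul_of_nonneg_right (mul_le_mul hLtΛ hBξ hBξ0 hΛ0) (by positivity)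
  have t4 : δ * enp1 ≤ 6 * ((n : ℝ) + 1) * τ ^ 4 * enp1 := mul_le_mul_of_nonneg_right hδ henp1
  calc 5 * Bw * en + Lt * Bw * en1 + Lt * Bξ * (en + 20) + δ * enp1
      ≤ 5 * (2 * ((n : ℝ) + 2 + C₁) * τ ^ 4) * en + Λ * (2 * ((n : ℝ) + 2 + C₁) * τ ^ 4) * en1 +
          Λ * (2 * (1 + C₁) * τ ^ 4) * (en + 20) + 6 * ((n : ℝ) + 1) * τ ^ 4 * enp1 := by linarith
    _ = _ := by ring

variable {ι : Type*} (E : Finset ι) (I : ι → Ideal (𝓞 K)) {X τ C₁ C₇ M Err CN : ℝ} {n : ℕ}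

open scoped Classical in
/-- **The per-`n` estimate in the `τ⁴ g(n)` form.** For a general family satisfying the
normIn form of Lemma 7.1 (`h7`), with `μ = ⌊τξ^{-1}⌋`, `(log X)^{-1} ≤ τ⁵` and
`2C₁τ⁴ ≤ 1`: `|U₁^(n) − Û^(n)| ≤ (E1) + (E3ii) + (E4) + C₇ M (τ log X)^{-1} τ⁴ g(n) + 70 (log X) C₇ Err`,
`g(n) = (n+2+C₁)(10 e_n + 2Λ e_{n-1}) + 2(1+C₁)Λ(e_n + 20) + 6(n+1)e_{n+1}`, `Λ = log(2/τ) + 1`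
("each O(ξτ^{-5}) = o(1) as required", p. 46). [cite: HeathBrownActa2001, Lemma 3.7 via §7 pp. 44–46] -/
theorem U_bound_tau4 (hC₁ : 0 ≤ C₁)
    (hwin : ∀ (lo hi : ℝ) (T : Finset ℕ), 2 ≤ lo → lo ≤ hi →
      (∀ p ∈ T, p.Prime ∧ lo < (p : ℝ) ∧ (p : ℝ) ≤ hi) →
      ∑ p ∈ T, (idealNormCount K p : ℝ) * (p : ℝ)⁻¹ ≤
        Real.log (Real.log hi / Real.log lo) + C₁ / Real.log lo)
    (hX : (2 : ℝ) ^ 15 ≤ X) (hτ : 0 < τ) (hτ1 : τ ≤ 1 / 40) (hXτ : 4 ≤ X ^ τ)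
    (hXτ2 : 2 * X ^ τ ≤ X ^ (1 / 2 : ℝ)) (hCN : CN < X ^ (3 * τ))
    (hE : ∀ i ∈ E, I i ≠ ⊥ ∧ (Ideal.absNorm (I i) : ℝ) ≤ CN * X ^ 3)
    (hC₇ : 0 ≤ C₇) (hM : 0 ≤ M) (hErr : 0 ≤ Err)
    (h7 : ∀ (N z : ℝ) (𝒬 : Finset ℕ), X ^ τ ≤ z → 0 < N → N ≤ X ^ (2 - 2 * τ) →
        (∀ q ∈ 𝒬, Squarefree q ∧ N < q ∧ (q : ℝ) ≤ 2 * N) →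
        ∑ Q ∈ normIn 𝒬, (famSifted E I Q z : ℝ) ≤
          C₇ * (M / Real.log (min z (X ^ (2 - τ) / N)) *
            ∑ Q ∈ normIn 𝒬, ((Ideal.absNorm Q : ℕ) : ℝ)⁻¹ + Err))
    (hLτ : 1 / Real.log X ≤ τ ^ 5) (hC₁τ : 2 * C₁ * τ ^ 4 ≤ 1)
    (hn : 1 ≤ n) (hnτ : (n : ℝ) ≤ 1 / τ + 1) :
    |(U1piece E I X τ n : ℝ) - Uhat X τ E I n| ≤
      ∑ t ∈ (Upairs X τ n).filter (fun t => ¬ UGood t), (famCount E I (uIdeal t) : ℝ) +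
      ∑ b ∈ (mIndexU τ n).sigma (fun m => Fintype.piFinset fun i => Jprimes X τ (m i)),
        ∑ Q ∈ ((idealsLE (Ideal.absNorm (b.2 (Fin.last n)))).filter
            (fun Q => Q.IsPrime ∧ Q ≠ ⊥ ∧ X ^ ((b.1 (Fin.last n) : ℝ) * hbXi τ) ≤ (Ideal.absNorm Q : ℝ) ∧
              PrimeLT Q (b.2 (Fin.last n)))).filter
            (fun Q => ¬ ((Ideal.absNorm Q).Prime ∧ ∀ j, Ideal.absNorm Q ≠ Ideal.absNorm (b.2 j))),
          (famCount E I (Q * ∏ j, b.2 j) : ℝ) +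
      ∑ b ∈ (mIndexU τ n).sigma (fun m => Fintype.piFinset fun i => Jprimes X τ (m i)),
        (#{i ∈ E | (∏ j, b.2 j) ∣ I i ∧ IsRough (X ^ ((b.1 (Fin.last n) : ℝ) * hbXi τ)) (I i) ∧
            ¬ Squarefree (Ideal.absNorm (I i) / Ideal.absNorm (∏ j, b.2 j))} : ℝ) +
      C₇ * (M / (τ * Real.log X)) * (τ ^ 4 *
        ((((n : ℝ) + 2 + C₁) *
            (10 * (∑ σ' ∈ ((range (⌊X ^ (1 - τ)⌋₊ + 1)).filter
                (fun p : ℕ => p.Prime ∧ X ^ τ ≤ (p : ℝ) ∧ (p : ℝ) < X ^ (1 - τ))).powersetCard n,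
              ∏ p ∈ σ', (idealNormCount K p : ℝ) * (p : ℝ)⁻¹) +
             2 * (Real.log (2 / τ) + 1) *
              (∑ σ' ∈ ((range (⌊X ^ (1 - τ)⌋₊ + 1)).filter
                (fun p : ℕ => p.Prime ∧ X ^ τ ≤ (p : ℝ) ∧ (p : ℝ) < X ^ (1 - τ))).powersetCard (n - 1),
              ∏ p ∈ σ', (idealNormCount K p : ℝ) * (p : ℝ)⁻¹)) +
          2 * (1 + C₁) * (Real.log (2 / τ) + 1) *
            (∑ σ' ∈ ((range (⌊X ^ (1 - τ)⌋₊ + 1)).filter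
                (fun p : ℕ => p.Prime ∧ X ^ τ ≤ (p : ℝ) ∧ (p : ℝ) < X ^ (1 - τ))).powersetCard n,
              ∏ p ∈ σ', (idealNormCount K p : ℝ) * (p : ℝ)⁻¹ + 20) +
          6 * ((n : ℝ) + 1) *
            (∑ σ' ∈ ((range (⌊X ^ (1 - τ)⌋₊ + 1)).filter
                (fun p : ℕ => p.Prime ∧ X ^ τ ≤ (p : ℝ) ∧ (p : ℝ) < X ^ (1 - τ))).powersetCard (n + 1),
              ∏ p ∈ σ', (idealNormCount K p : ℝ) * (p : ℝ)⁻¹)))) +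
      70 * Real.log X * (C₇ * Err) := by
  classical
  have hX1 : 1 < X := lt_of_lt_of_le (by norm_num) hX
  have hL : 0 < Real.log X := Real.log_pos hX1
  obtain ⟨hμ, hμle, -⟩ := mu_props hτ (by linarith)
  obtain ⟨hδ, hδ1⟩ := delta_le hτ hτ1 hnτ
  have hU := U_bound_of_h7 E I hC₁ hwin hX hτ hτ1 hXτ hXτ2 hCN hE hC₇ hM hErr h7 hn hμ hμle
  have hP0 : ∀ p ∈ (range (⌊X ^ (1 - τ)⌋₊ + 1)).filter
      (fun p : ℕ => p.Prime ∧ X ^ τ ≤ (p : ℝ) ∧ (p : ℝ) < X ^ (1 - τ)),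
      p.Prime ∧ X ^ τ ≤ (p : ℝ) ∧ (p : ℝ) < X ^ (1 - τ) := fun p hp => (mem_filter.mp hp).2
  have hLt := smallPrimes_normWt_le hC₁ hwin hX1 hτ (by linarith) hXτ _ hP0
  have hτL : 1 ≤ τ ^ 5 * Real.log X := by rwa [div_le_iff₀ hL] at hLτ
  have h2C : 2 * C₁ / (τ * Real.log X) ≤ 1 := by
    rw [div_le_iff₀ (by positivity), one_mul]
    calc 2 * C₁ ≤ 2 * C₁ * (τ ^ 5 * Real.log X) := le_mul_of_one_le_right (by positivity) hτL
      _ = (2 * C₁ * τ ^ 4) * (τ * Real.log X) := by ring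
      _ ≤ 1 * (τ * Real.log X) := mul_le_mul_of_nonneg_right hC₁τ (by positivity)
      _ = τ * Real.log X := one_mul _
  have hLtΛ : _ ≤ Real.log (2 / τ) + 1 := hLt.trans (by linarith)
  have hLt0 := sum_nonneg (normWt_nonneg_on ((range (⌊X ^ (1 - τ)⌋₊ + 1)).filter
      (fun p : ℕ => p.Prime ∧ X ^ τ ≤ (p : ℝ) ∧ (p : ℝ) < X ^ (1 - τ))))
  have hP0n := fun j => esymm_nonneg ((range (⌊X ^ (1 - τ)⌋₊ + 1)).filter
      (fun p : ℕ => p.Prime ∧ X ^ τ ≤ (p : ℝ) ∧ (p : ℝ) < X ^ (1 - τ)))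
    (fun p : ℕ => (idealNormCount K p : ℝ) * (p : ℝ)⁻¹) (normWt_nonneg_on _) j
  refine hU.trans (add_le_add (add_le_add le_rfl (mul_le_mul_of_nonneg_left
    (bracket_le_tau4 (Λ := Real.log (2 / τ) + 1) hτ hL hLτ hC₁ hLt0 hLtΛ (hP0n n) (hP0n (n - 1))
      (hP0n (n + 1)) hδ) (by positivity : (0 : ℝ) ≤ C₇ * (M / (τ * Real.log X))))) ?_)
  have h70 : 66 + 3 * ((1 + 1 / ((⌊τ / hbXi τ⌋₊ : ℕ) : ℝ)) ^ (n + 1) - 1) ≤ 70 := by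
    linarith [hδ.trans hδ1]
  exact mul_le_mul_of_nonneg_right (mul_le_mul_of_nonneg_right h70 hL.le) (by positivity)


open scoped Classical in
/-- **The sum over `n` of the per-`n` estimates** (general family): for `N ≤ τ^{-1} + 1`
(`N = n₀ = chainBound τ`), `(log X)^{-1} ≤ τ⁵`, `2C₁τ⁴ ≤ 1`,
`∑_{1 ≤ n ≤ N} |U₁^(n) − Û^(n)| ≤ ∑_n (E1 + E3ii + E4)(n) + C₇M(τ log X)^{-1}·(1600 + 700C₁)τ² + 70(τ^{-1}+1)(log X)C₇Err`
(`∑_n τ⁴ g(n) ≤ (1600 + 700 C₁)τ²` by `sum_bracket_le`, `bracket_total_le`; p. 46: "each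
`O(ξτ^{-5}) = o(1)`, … `n ≪ τ^{-1}`"). [cite: HeathBrownActa2001, Lemma 3.7 via §7 pp. 44–46] -/
theorem U_sum_bound (hC₁ : 0 ≤ C₁)
    (hwin : ∀ (lo hi : ℝ) (T : Finset ℕ), 2 ≤ lo → lo ≤ hi →
      (∀ p ∈ T, p.Prime ∧ lo < (p : ℝ) ∧ (p : ℝ) ≤ hi) →
      ∑ p ∈ T, (idealNormCount K p : ℝ) * (p : ℝ)⁻¹ ≤
        Real.log (Real.log hi / Real.log lo) + C₁ / Real.log lo)
    (hX : (2 : ℝ) ^ 15 ≤ X) (hτ : 0 < τ) (hτ1 : τ ≤ 1 / 40) (hXτ : 4 ≤ X ^ τ)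
    (hXτ2 : 2 * X ^ τ ≤ X ^ (1 / 2 : ℝ)) (hCN : CN < X ^ (3 * τ))
    (hE : ∀ i ∈ E, I i ≠ ⊥ ∧ (Ideal.absNorm (I i) : ℝ) ≤ CN * X ^ 3)
    (hC₇ : 0 ≤ C₇) (hM : 0 ≤ M) (hErr : 0 ≤ Err)
    (h7 : ∀ (N z : ℝ) (𝒬 : Finset ℕ), X ^ τ ≤ z → 0 < N → N ≤ X ^ (2 - 2 * τ) →
        (∀ q ∈ 𝒬, Squarefree q ∧ N < q ∧ (q : ℝ) ≤ 2 * N) →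
        ∑ Q ∈ normIn 𝒬, (famSifted E I Q z : ℝ) ≤
          C₇ * (M / Real.log (min z (X ^ (2 - τ) / N)) *
            ∑ Q ∈ normIn 𝒬, ((Ideal.absNorm Q : ℕ) : ℝ)⁻¹ + Err))
    (hLτ : 1 / Real.log X ≤ τ ^ 5) (hC₁τ : 2 * C₁ * τ ^ 4 ≤ 1)
    {N : ℕ} (hN : (N : ℝ) ≤ 1 / τ + 1) :
    ∑ n ∈ Icc 1 N, |(U1piece E I X τ n : ℝ) - Uhat X τ E I n| ≤
      ∑ n ∈ Icc 1 N,
        (∑ t ∈ (Upairs X τ n).filter (fun t => ¬ UGood t), (famCount E I (uIdeal t) : ℝ) +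
        ∑ b ∈ (mIndexU τ n).sigma (fun m => Fintype.piFinset fun i => Jprimes X τ (m i)),
          ∑ Q ∈ ((idealsLE (Ideal.absNorm (b.2 (Fin.last n)))).filter
              (fun Q => Q.IsPrime ∧ Q ≠ ⊥ ∧ X ^ ((b.1 (Fin.last n) : ℝ) * hbXi τ) ≤ (Ideal.absNorm Q : ℝ) ∧
                PrimeLT Q (b.2 (Fin.last n)))).filter
              (fun Q => ¬ ((Ideal.absNorm Q).Prime ∧ ∀ j, Ideal.absNorm Q ≠ Ideal.absNorm (b.2 j))),
            (famCount E I (Q * ∏ j, b.2 j) : ℝ) +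
        ∑ b ∈ (mIndexU τ n).sigma (fun m => Fintype.piFinset fun i => Jprimes X τ (m i)),
          (#{i ∈ E | (∏ j, b.2 j) ∣ I i ∧ IsRough (X ^ ((b.1 (Fin.last n) : ℝ) * hbXi τ)) (I i) ∧
              ¬ Squarefree (Ideal.absNorm (I i) / Ideal.absNorm (∏ j, b.2 j))} : ℝ)) +
      C₇ * (M / (τ * Real.log X)) * ((1600 + 700 * C₁) * τ ^ 2) +
      70 * (1 / τ + 1) * Real.log X * (C₇ * Err) := by
  classical
  have hX1 : 1 < X := lt_of_lt_of_le (by norm_num) hX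
  have hL : 0 < Real.log X := Real.log_pos hX1
  have hτ1' : τ ≤ 1 := by linarith
  -- the weights
  set P0 := ((range (⌊X ^ (1 - τ)⌋₊ + 1)).filter
                (fun p : ℕ => p.Prime ∧ X ^ τ ≤ (p : ℝ) ∧ (p : ℝ) < X ^ (1 - τ))) with hP0
  set e : ℕ → ℝ := fun j => ∑ σ' ∈ P0.powersetCard j, ∏ p ∈ σ', (idealNormCount K p : ℝ) * (p : ℝ)⁻¹
    with he
  set Λ : ℝ := Real.log (2 / τ) + 1 with hΛ
  have hP0mem : ∀ p ∈ P0, p.Prime ∧ X ^ τ ≤ (p : ℝ) ∧ (p : ℝ) < X ^ (1 - τ) :=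
    fun p hp => (mem_filter.mp hp).2
  have hLt := smallPrimes_normWt_le hC₁ hwin hX1 hτ (by linarith) hXτ _ hP0mem
  have hτL : 1 ≤ τ ^ 5 * Real.log X := by rwa [div_le_iff₀ hL] at hLτ
  have h2C : 2 * C₁ / (τ * Real.log X) ≤ 1 := by
    rw [div_le_iff₀ (by positivity), one_mul]
    calc 2 * C₁ ≤ 2 * C₁ * (τ ^ 5 * Real.log X) := le_mul_of_one_le_right (by positivity) hτL
      _ = (2 * C₁ * τ ^ 4) * (τ * Real.log X) := by ring
      _ ≤ 1 * (τ * Real.log X) := mul_le_mul_of_nonneg_right hC₁τ (by positivity)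
      _ = τ * Real.log X := one_mul _
  have hLtΛ : ∑ p ∈ P0, (idealNormCount K p : ℝ) * (p : ℝ)⁻¹ ≤ Λ := hLt.trans (by rw [hΛ]; linarith)
  have hLt0 : 0 ≤ ∑ p ∈ P0, (idealNormCount K p : ℝ) * (p : ℝ)⁻¹ := sum_nonneg (normWt_nonneg_on P0)
  have he0 : ∀ j, 0 ≤ e j := fun j => esymm_nonneg P0 _ (normWt_nonneg_on P0) j
  have heΛ : ∀ j, e j ≤ Λ ^ j / j.factorial := fun j =>
    (esymm_le_pow_div_factorial P0 _ (normWt_nonneg_on P0) j).trans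
      (div_le_div_of_nonneg_right (pow_le_pow_left₀ hLt0 hLtΛ j) (by positivity))
  have hlog2τ : 0 ≤ Real.log (2 / τ) := Real.log_nonneg (by rw [le_div_iff₀ hτ]; linarith)
  have hΛ1 : 1 ≤ Λ := by rw [hΛ]; linarith
  -- per-`n` bounds, summed
  have hper : ∀ n ∈ Icc 1 N, |(U1piece E I X τ n : ℝ) - Uhat X τ E I n| ≤
      (∑ t ∈ (Upairs X τ n).filter (fun t => ¬ UGood t), (famCount E I (uIdeal t) : ℝ) +
        ∑ b ∈ (mIndexU τ n).sigma (fun m => Fintype.piFinset fun i => Jprimes X τ (m i)),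
          ∑ Q ∈ ((idealsLE (Ideal.absNorm (b.2 (Fin.last n)))).filter
              (fun Q => Q.IsPrime ∧ Q ≠ ⊥ ∧ X ^ ((b.1 (Fin.last n) : ℝ) * hbXi τ) ≤ (Ideal.absNorm Q : ℝ) ∧
                PrimeLT Q (b.2 (Fin.last n)))).filter
              (fun Q => ¬ ((Ideal.absNorm Q).Prime ∧ ∀ j, Ideal.absNorm Q ≠ Ideal.absNorm (b.2 j))),
            (famCount E I (Q * ∏ j, b.2 j) : ℝ) +
        ∑ b ∈ (mIndexU τ n).sigma (fun m => Fintype.piFinset fun i => Jprimes X τ (m i)),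
          (#{i ∈ E | (∏ j, b.2 j) ∣ I i ∧ IsRough (X ^ ((b.1 (Fin.last n) : ℝ) * hbXi τ)) (I i) ∧
              ¬ Squarefree (Ideal.absNorm (I i) / Ideal.absNorm (∏ j, b.2 j))} : ℝ)) +
      C₇ * (M / (τ * Real.log X)) * (τ ^ 4 *
        ((((n : ℝ) + 2 + C₁) * (10 * e n + 2 * Λ * e (n - 1)) +
          2 * (1 + C₁) * Λ * (e n + 20) + 6 * ((n : ℝ) + 1) * e (n + 1)))) +
      70 * Real.log X * (C₇ * Err) := by
    intro n hn
    rw [mem_Icc] at hn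
    have hnτ : (n : ℝ) ≤ 1 / τ + 1 := le_trans (by exact_mod_cast hn.2) hN
    exact U_bound_tau4 E I hC₁ hwin hX hτ hτ1 hXτ hXτ2 hCN hE hC₇ hM hErr h7 hLτ hC₁τ hn.1 hnτ
  refine (sum_le_sum hper).trans ?_
  rw [sum_add_distrib, sum_add_distrib, ← mul_sum, ← mul_sum, sum_const, Nat.card_Icc,
    Nat.add_sub_cancel, nsmul_eq_mul]
  -- the summed brackets
  have hbr := sum_bracket_le hΛ1 hC₁ e he0 heΛ N
  have htot := bracket_total_le (C₁ := C₁) hτ hτ1' hC₁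
  have hN2 : (N : ℝ) ≤ 1 / τ + 2 := by linarith
  have hsumg : τ ^ 4 * ∑ n ∈ Icc 1 N, (((n : ℝ) + 2 + C₁) * (10 * e n + 2 * Λ * e (n - 1)) +
      2 * (1 + C₁) * Λ * (e n + 20) + 6 * ((n : ℝ) + 1) * e (n + 1)) ≤ (1600 + 700 * C₁) * τ ^ 2 := by
    refine le_trans (mul_le_mul_of_nonneg_left (hbr.trans ?_) (by positivity)) htot
    have : 40 * (1 + C₁) * Λ * (N : ℝ) ≤ 40 * (1 + C₁) * Λ * (1 / τ + 2) :=
      mul_le_mul_of_nonneg_left hN2 (by positivity)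
    linarith
  have hc0 : (0 : ℝ) ≤ C₇ * (M / (τ * Real.log X)) := by positivity
  have h1 := mul_le_mul_of_nonneg_left hsumg hc0
  have h2 : (N : ℝ) * (70 * Real.log X * (C₇ * Err)) ≤ 70 * (1 / τ + 1) * Real.log X * (C₇ * Err) := by
    calc (N : ℝ) * (70 * Real.log X * (C₇ * Err)) ≤ (1 / τ + 1) * (70 * Real.log X * (C₇ * Err)) :=
          mul_le_mul_of_nonneg_right hN (by positivity)
      _ = _ := by ring
  linarith [h1, h2]

/-- **`U^(n) = U₁^(n)` for `n ≥ 3`** (`τ ≤ 1/14`, `X > 1`): `N(P_{n+1})^n ≤ N(P_1⋯P_n) < X^{1+τ}`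
gives `N(P_1⋯P_{n+1}) < X^{(1+τ)(1+1/n)} ≤ X^{3/2−τ}` (p. 13: "For `n ≥ 3` … automatically").
[cite: HeathBrownActa2001, §3 p. 13] -/
theorem Upiece_eq_U1piece (hX : 1 < X) (hτ : 0 < τ) (hτ1 : τ ≤ 1 / 14) (hn : 3 ≤ n) :
    Upiece E I X τ n = U1piece E I X τ n := by
  classical
  have hX0 : 0 < X := by linarith
  rw [U1piece, UpieceWhere, Upiece]
  refine (sum_congr (filter_true_of_mem fun sP hsP => ?_).symm fun _ _ => rfl)
  obtain ⟨hs, -, hlt, -⟩ := mem_Upairs_iff.mp hsP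
  obtain ⟨-, hcard, hprod⟩ := mem_chains_iff.mp hs
  have hNP : ∀ Q ∈ sP.1, Ideal.absNorm sP.2 ≤ Ideal.absNorm Q := fun Q hQ => (hlt Q hQ).absNorm_le
  have ha : ((Ideal.absNorm (∏ P ∈ sP.1, P) : ℕ) : ℝ) = ∏ Q ∈ sP.1, ((Ideal.absNorm Q : ℕ) : ℝ) := by
    rw [map_prod, Nat.cast_prod]
  have hn0 : (n : ℝ) ≠ 0 := by
    have h3 : (3 : ℝ) ≤ n := by exact_mod_cast hn
    exact ne_of_gt (by linarith)
  have hpn : ((Ideal.absNorm sP.2 : ℕ) : ℝ) ^ n ≤ ((Ideal.absNorm (∏ P ∈ sP.1, P) : ℕ) : ℝ) := by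
    rw [ha, ← hcard, ← prod_const]
    exact prod_le_prod (fun _ _ => by positivity) fun Q hQ => by exact_mod_cast hNP Q hQ
  have hplt : ((Ideal.absNorm sP.2 : ℕ) : ℝ) < X ^ ((1 + τ) / n) := by
    by_contra h
    rw [not_lt] at h
    have h' : X ^ (1 + τ) ≤ ((Ideal.absNorm sP.2 : ℕ) : ℝ) ^ n := by
      calc X ^ (1 + τ) = (X ^ ((1 + τ) / n)) ^ n := by
            rw [← Real.rpow_natCast, ← Real.rpow_mul hX0.le, div_mul_cancel₀ _ hn0]
        _ ≤ _ := pow_le_pow_left₀ (by positivity) h n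
    linarith
  show (((Ideal.absNorm (∏ P ∈ sP.1, P) * Ideal.absNorm sP.2 : ℕ)) : ℝ) ≤ X ^ (3 / 2 - τ)
  push_cast
  have hexp : (1 + τ) + (1 + τ) / n ≤ 3 / 2 - τ := by
    have hn3 : (3 : ℝ) ≤ n := by exact_mod_cast hn
    have h1 : (1 + τ) / n ≤ (1 + τ) / 3 := div_le_div_of_nonneg_left (by linarith) (by norm_num) hn3
    linarith
  calc ((Ideal.absNorm (∏ P ∈ sP.1, P) : ℕ) : ℝ) * ((Ideal.absNorm sP.2 : ℕ) : ℝ)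
      ≤ X ^ (1 + τ) * X ^ ((1 + τ) / n) := mul_le_mul hprod.le hplt.le (by positivity) (by positivity)
    _ = X ^ ((1 + τ) + (1 + τ) / n) := by rw [← Real.rpow_add hX0]
    _ ≤ X ^ (3 / 2 - τ) := Real.rpow_le_rpow_of_exponent_le hX.le hexp

end Literature.NumberTheory.Sieve.CubicSieve

end
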